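import Literature.NumberTheory.EllipticCurves.DeShalit1987.KatzDistributionFromLMeasure
import Literature.NumberTheory.EllipticCurves.ZpExtensionPRamifiedEmbeddingProofs
import HarnessLib

/-!
# de Shalit 1987, II.4.12 Remark (i) / 4.16: the Galois group `𝒢(𝔣p^∞) = Gal(K(𝔣p^∞)/K)` AS A TOWER —
# `Gal(K̄/K(𝔣p^∞)) = ⋂_m Gal(K̄/C_{𝔪^m})` for `𝔪 = p · ∏_{w∈S} w`, by the tree's (proved) class field theory

The measure currency of `KatzDistributionFromLMeasure.lean` presents de Shalit's `𝒢(𝔣p^∞)`,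
`𝔣 = ∏_{w∈S} w^∞`, as `Γ_K ⧸ DeShalit1987.rayKer K p S` with `rayKer` the closed normal subgroup
generated by the commutators and the inertia groups at the finite places outside `S ∪ {w ∣ p}`, and a
measure on it as a `GroupDistribution` along ANY tower of open subgroups `𝒰` with
`⋂ U_n ⊆ rayKer K p S` (hypothesis of `IsLMeasure.isKatzDistribution₂` and of the named fact
`thmII414_exists_lMeasure`). This file DISCHARGES that Galois-side hypothesis for the canonical tower
of RAY CLASS FIELDS — the tower along which de Shalit's construction II.4.4–4.14 actually runs
(`F_n = K(𝔣𝔭ⁿ)`, `K(𝔤p^n)`) — using the tree's PROVED global class field theory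
(`rayClassField`, the conductor, `ZpExtensionPRamifiedEmbeddingProofs`):

* §1 the modulus `rayModulus K p S = (p) · ∏_{w∈S} 𝔭_w` (its prime support is exactly
  `{w ∣ p} ∪ S`);
* §2 `rayKer K p S ≤ Gal(K̄/C_𝔪)` for every `𝔪 ≠ 0` supported on `{w ∣ p} ∪ S`
  (`rayKer_le_ker_absRestrictNormalHom_rayClassField`; `C_𝔪` is abelian and unramified outside `𝔪`);
* §3 for `K` TOTALLY COMPLEX: every open subgroup of `Γ_K` containing `rayKer K p S` contains some
  `Gal(K̄/C_{𝔪^m})` (`exists_ker_absRestrictNormalHom_rayClassField_le_of_rayKer_le`: the fixed field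
  is a finite abelian extension unramified outside `S ∪ {w ∣ p}`, so its conductor divides a power of
  `𝔪` — Neukirch VI (6.6) — and it lies in `C_{𝔪^m}`; no archimedean condition since `K` has no real
  place), hence **`rayKer K p S = ⋂_{m ≥ 1} Gal(K̄/C_{𝔪^m})`**
  (`mem_rayKer_iff_forall_absRestrictNormalHom_rayClassField_eq_one`);
* §4 **`DeShalit1987.rayClassTower K p S : SubgroupTower Γ_K`**, `U_m = Gal(K̄/C_{𝔪^{m+1}})`: open
  normal finite-index subgroups, `rayKer ≤ U_m`, and for totally complex `K`
  **`iInter_rayClassTower_subset_rayKer : ⋂_m U_m ⊆ rayKer K p S`** — so a `GroupDistribution` along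
  `rayClassTower K p S` with `IsLMeasure` is literally a measure on `𝒢(𝔣p^∞)` as in II.4.12 / 4.14,
  and feeds `IsLMeasure.isKatzDistribution₂` / `thmII414_exists_lMeasure` with no further
  Galois-theoretic input (`exists_tower_of_isLMeasure_rayClassTower`).

The `S = ∅` case is the tree's `PRamified` theory (`kerSubgroup K p`, Lang Ch. 5 §5); here the same
arguments are run for a general finite `S` (and without the complex conjugations among the generators,
whence the restriction to totally complex `K` in §3 — the case of de Shalit's imaginary quadratic `K`).
THEOREMS AND DEFINITIONS WITH BODIES ONLY; no named fact, no `sorry`, no instance.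

## References

* [deShalit1987] E. de Shalit, *Iwasawa theory of elliptic curves with complex multiplication* (1987),
  II.4.12 Remark (i) (p. 67), II.4.13 (p. 69), II.4.16 (p. 76).
* [NeukirchANT1999] J. Neukirch, *Algebraic Number Theory*, Ch. VI §6 Def. (6.2), (6.4), Cor. (6.6);
  Ch. IV §1 (Krull topology).
* [Lang1990] S. Lang, *Cyclotomic Fields I and II*, Ch. 5 §5.
-/

noncomputable section

open scoped NumberField Pointwise
open NumberField IsDedekindDomain Field Topology Filter
open Literature.NumberTheory.GaloisRepresentations Literature.NumberTheory.NumberFields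
  Literature.NumberTheory.Automorphic

namespace Literature.NumberTheory.EllipticCurves

namespace DeShalit1987

variable {K : Type} [Field K] [NumberField K] (p : ℕ) (S : Finset (HeightOneSpectrum (𝓞 K)))

/-! ### §1. The modulus `𝔪 = (p) · ∏_{w ∈ S} 𝔭_w` -/

/-- **The modulus `𝔪_S = (p) · ∏_{w∈S} 𝔭_w`** of `𝓞 K`, whose prime support is `{w ∣ p} ∪ S`: the
ray class fields `C_{𝔪_S^m}` exhaust `K(𝔣p^∞)`, `𝔣 = ∏_{w∈S} w^∞` (de Shalit II.4.12 Remark (i): the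
pseudo-ideal `𝔣𝔤^∞`). [cite: deShalit1987, II.4.12 Remark (i) (p. 67)] -/
def rayModulus (K : Type) [Field K] [NumberField K] (p : ℕ) (S : Finset (HeightOneSpectrum (𝓞 K))) :
    Ideal (𝓞 K) :=
  Ideal.span {(p : 𝓞 K)} * ∏ w ∈ S, w.asIdeal

/-- The modulus is contained in every prime above `p`. [cite: deShalit1987, II.4.12 Remark (i) (p. 67)] -/
theorem rayModulus_le_of_mem {v : HeightOneSpectrum (𝓞 K)} (hv : (p : 𝓞 K) ∈ v.asIdeal) :
    rayModulus K p S ≤ v.asIdeal :=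
  Ideal.mul_le_right.trans ((Ideal.span_singleton_le_iff_mem _).mpr hv)

/-- The modulus is contained in every prime of `S`. [cite: deShalit1987, II.4.12 Remark (i) (p. 67)] -/
theorem rayModulus_le_of_mem_finset {v : HeightOneSpectrum (𝓞 K)} (hv : v ∈ S) :
    rayModulus K p S ≤ v.asIdeal :=
  Ideal.mul_le_left.trans ((Ideal.prod_le_inf).trans (Finset.inf_le hv))

/-- `rayKer K p S` is a normal subgroup. [cite: Lang1990, Ch. 5 §5] -/
theorem rayKer_normal : (rayKer K p S).Normal := by
  rw [rayKer]
  exact Subgroup.is_normal_topologicalClosure _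

/-- `rayKer K p S` is closed. [cite: Lang1990, Ch. 5 §5] -/
theorem isClosed_rayKer : IsClosed (rayKer K p S : Set (absoluteGaloisGroup K)) := by
  rw [rayKer]
  exact Subgroup.isClosed_topologicalClosure _

/-- The commutator subgroup lies in `rayKer`. [cite: Lang1990, Ch. 5 §5] -/
theorem commutator_le_rayKer : commutator (absoluteGaloisGroup K) ≤ rayKer K p S :=
  fun _ h ↦ Subgroup.le_topologicalClosure _ (Subgroup.subset_normalClosure (commutator_subset_rayGenerators h))

/-- The inertia groups at `w ∉ S`, `w ∤ p` lie in `rayKer`. [cite: Lang1990, Ch. 5 §5] -/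
theorem inertia_le_rayKer {w : HeightOneSpectrum (𝓞 K)} (hwS : w ∉ S) (hwp : ((p : ℕ) : 𝓞 K) ∉ w.asIdeal)
    {𝔓 : Ideal (absIntegers (𝓞 K) K)} (h𝔓 : 𝔓 ∈ w.primesAbove) :
    𝔓.inertia (absoluteGaloisGroup K) ≤ rayKer K p S :=
  fun _ h ↦ Subgroup.le_topologicalClosure _
    (Subgroup.subset_normalClosure (mem_rayGenerators_of_mem_inertia hwS hwp h𝔓 h))

omit [NumberField K] in
/-- If `L ≤ L'` are finite normal subextensions of `K̄`, whatever restricts trivially to `L'`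
restricts trivially to `L`. [folklore] -/
private theorem ker_absRestrictNormalHom_anti' {L L' : IntermediateField K (AlgebraicClosure K)}
    [Normal K L] [Normal K L'] (h : L ≤ L') : (absRestrictNormalHom L').ker ≤ (absRestrictNormalHom L).ker := by
  intro γ hγ
  rw [MonoidHom.mem_ker, absRestrictNormalHom_eq_one_iff, IntermediateField.mem_fixingSubgroup_iff] at hγ ⊢
  exact fun x hx ↦ hγ x (h hx)

omit [NumberField K] in
/-- For a finite ABELIAN `L ⊆ K̄`, the commutator subgroup of `Γ_K` restricts trivially to `L`.
[folklore] -/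
private theorem commutator_le_ker_absRestrictNormalHom' (L : IntermediateField K (AlgebraicClosure K))
    [IsAbelianGalois K L] : commutator (absoluteGaloisGroup K) ≤ (absRestrictNormalHom L).ker := by
  rw [commutator_eq_closure, Subgroup.closure_le]
  rintro g ⟨a, b, rfl⟩
  rw [SetLike.mem_coe, MonoidHom.mem_ker, map_commutatorElement, commutatorElement_eq_one_iff_commute]
  exact commute_of_isAbelianGalois L _ _

/-- `W_𝔪` is antitone in the modulus: `𝔪' ≤ 𝔪`, `𝔪' ≠ 0` give `W_{𝔪'} ≤ W_𝔪`.
[cite: NeukirchANT1999, Ch. VI §1 Def. (1.7)] -/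
private theorem rayUnitIdeles_anti {𝔪 𝔪' : Ideal (𝓞 K)} (h𝔪' : 𝔪' ≠ ⊥) (h : 𝔪' ≤ 𝔪) :
    rayUnitIdeles K 𝔪' ≤ rayUnitIdeles K 𝔪 := by
  intro x hx
  rw [mem_rayUnitIdeles_iff] at hx ⊢
  intro v
  refine ⟨(hx v).1, (hx v).2.trans ?_⟩
  rw [WithZero.exp_le_exp, neg_le_neg_iff]
  exact FractionalIdeal.count_mono K v (FractionalIdeal.coeIdeal_ne_zero.2 h𝔪')
    ((FractionalIdeal.coeIdeal_le_coeIdeal K).2 h)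

variable [Fact p.Prime]

/-- The modulus is non-zero. [cite: deShalit1987, II.4.12 Remark (i) (p. 67)] -/
theorem rayModulus_ne_bot : rayModulus K p S ≠ ⊥ := by
  rw [rayModulus]
  refine mul_ne_zero ?_ (Finset.prod_ne_zero_iff.mpr fun w _ ↦ w.ne_bot)
  rw [Ne, Ideal.zero_eq_bot, Ideal.span_singleton_eq_bot]
  exact_mod_cast (Fact.out : p.Prime).ne_zero

/-- The powers of the modulus are non-zero. [cite: deShalit1987, II.4.12 Remark (i) (p. 67)] -/
theorem rayModulus_pow_ne_bot (m : ℕ) : rayModulus K p S ^ m ≠ ⊥ :=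
  pow_ne_zero m (rayModulus_ne_bot p S)

omit [Fact p.Prime] in
/-- **The prime support of the modulus is `{w ∣ p} ∪ S`**: a prime `v ∉ S`, `v ∤ p` does not contain
(any power of) the modulus. [cite: deShalit1987, II.4.12 Remark (i) (p. 67)] -/
theorem not_rayModulus_pow_le {v : HeightOneSpectrum (𝓞 K)} (hvS : v ∉ S)
    (hvp : (p : 𝓞 K) ∉ v.asIdeal) (m : ℕ) : ¬ rayModulus K p S ^ m ≤ v.asIdeal := by
  intro h
  have h1 : rayModulus K p S ≤ v.asIdeal := v.isPrime.le_of_pow_le h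
  rw [rayModulus, v.isPrime.mul_le] at h1
  rcases h1 with h1 | h1
  · exact hvp ((Ideal.span_singleton_le_iff_mem _).mp h1)
  · obtain ⟨w, hwS, hw⟩ := v.isPrime.prod_le.mp h1
    have hwv : w = v := by
      have hmax : w.asIdeal.IsMaximal := w.isPrime.isMaximal w.ne_bot
      exact HeightOneSpectrum.ext (hmax.eq_of_le v.isPrime.ne_top hw)
    exact hvS (hwv ▸ hwS)

/-! ### §2. `Gal(K̄/K(𝔣p^∞)) ≤ Gal(K̄/C_𝔪)` for `𝔪` supported on `{w ∣ p} ∪ S` -/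

omit [Fact p.Prime] in
/-- **`Gal(K̄/K(𝔣p^∞)) ≤ Gal(K̄/C_𝔪)`**: for `𝔪 ≠ 0` not contained in any prime `v ∉ S`, `v ∤ p`, the ray
class field `C_𝔪` (no archimedean condition) is abelian over `K` and unramified at every such `v`, so
the generators of `rayKer K p S` restrict trivially to it. [cite: NeukirchANT1999, Ch. VI §6 Def. (6.2) and Cor. (6.6)]
[cite: Lang1990, Ch. 5 §5, p. 106] -/
theorem rayKer_le_ker_absRestrictNormalHom_rayClassField {𝔪 : Ideal (𝓞 K)} (h𝔪 : 𝔪 ≠ ⊥)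
    (hS𝔪 : ∀ v : HeightOneSpectrum (𝓞 K), v ∉ S → (p : 𝓞 K) ∉ v.asIdeal → ¬ 𝔪 ≤ v.asIdeal) :
    rayKer K p S ≤ (absRestrictNormalHom (rayClassField K 𝔪)).ker := by
  refine Subgroup.topologicalClosure_minimal _ (Subgroup.normalClosure_le_normal ?_) ?_
  · intro τ hτ
    rcases mem_rayGenerators_iff.mp hτ with hτ | ⟨v, hvS, hvp, 𝔓, h𝔓, hτ⟩
    · exact commutator_le_ker_absRestrictNormalHom' (rayClassField K 𝔪) hτ
    · rw [SetLike.mem_coe, MonoidHom.mem_ker]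
      exact (isUnramifiedIn_iff_forall_inertia_absRestrictNormalHom_eq_one (rayClassField K 𝔪) v).mp
        (isUnramifiedIn_rayClassField h𝔪 (hS𝔪 v hvS hvp)) 𝔓 h𝔓 τ hτ
  · exact Subgroup.isClosed_of_isOpen _ (isOpen_ker_absRestrictNormalHom _)

/-- In particular `rayKer K p S ≤ Gal(K̄/C_{𝔪_S^m})`. [cite: NeukirchANT1999, Ch. VI §6 Cor. (6.6)] -/
theorem rayKer_le_ker_absRestrictNormalHom_rayClassField_pow (m : ℕ) :
    rayKer K p S ≤ (absRestrictNormalHom (rayClassField K (rayModulus K p S ^ m))).ker :=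
  rayKer_le_ker_absRestrictNormalHom_rayClassField p S (rayModulus_pow_ne_bot p S m)
    fun _ hvS hvp ↦ not_rayModulus_pow_le p S hvS hvp m

/-! ### §3. Totally complex `K`: every open subgroup above `rayKer` contains some `Gal(K̄/C_{𝔪^m})` -/

/-- **The conductor of an extension unramified outside `S ∪ {w ∣ p}` divides a power of `𝔪_S`**: for a
finite abelian `L ⊆ K̄` unramified at every `v ∉ S`, `v ∤ p`, every prime factor of its conductor `𝔣`
lies in `{w ∣ p} ∪ S` (Neukirch VI (6.6): `𝔭 ∣ 𝔣 ⟺ 𝔭` ramifies), hence contains `𝔪_S`; so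
`𝔪_S ⊆ √𝔣`, `𝔪_S^m ≤ 𝔣`, `𝔣 ∣ 𝔪_S^m`: `Kˣ · I_K^{𝔪_S^m} ≤ 𝒩_L`.
[cite: NeukirchANT1999, Ch. VI §6 Def. (6.4) and Cor. (6.6)] -/
theorem exists_principalIdeles_sup_congruenceUnitIdeles_rayModulus_pow_le_normGroup
    (L : IntermediateField K (AlgebraicClosure K)) [FiniteDimensional K L] [IsAbelianGalois K L] [NumberField L]
    (hunr : ∀ v : HeightOneSpectrum (𝓞 K), v ∉ S → (p : 𝓞 K) ∉ v.asIdeal →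
      Algebra.IsUnramifiedIn (𝓞 L) v.asIdeal) :
    ∃ m : ℕ, 0 < m ∧ principalIdeles K ⊔ congruenceUnitIdeles (rayModulus K p S ^ m) ≤
      Automorphic.normGroup K L := by
  -- `𝔪_S` lies in the radical of the conductor
  have hrad : rayModulus K p S ≤ (conductor L).radical := by
    rw [Ideal.radical_eq_sInf]
    refine le_sInf ?_
    rintro J ⟨hJ, hJprime⟩
    have hJ0 : J ≠ ⊥ := fun h ↦ conductor_ne_bot L (le_bot_iff.mp (h ▸ hJ))
    let v : HeightOneSpectrum (𝓞 K) := ⟨J, hJprime, hJ0⟩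
    by_cases hvS : v ∈ S
    · exact rayModulus_le_of_mem_finset p S hvS
    by_cases hvp : (p : 𝓞 K) ∈ v.asIdeal
    · exact rayModulus_le_of_mem p S hvp
    · exact absurd hJ ((isUnramifiedIn_iff_not_conductor_le L v).mp (hunr v hvS hvp))
  obtain ⟨n, hn⟩ := Ideal.exists_pow_le_of_le_radical_of_fg hrad (IsNoetherian.noetherian _)
  refine ⟨n + 1, Nat.succ_pos n, ?_⟩
  rw [← conductor_dvd_iff L (rayModulus_pow_ne_bot p S (n + 1)), Ideal.dvd_iff_le]
  exact (Ideal.pow_le_pow_right (Nat.le_succ n)).trans hn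

open scoped commutatorElement in
/-- **Every open subgroup of `Γ_K` containing `Gal(K̄/K(𝔣p^∞))` contains some `Gal(K̄/C_{𝔪_S^m})`**
(`K` totally complex): the fixed field `F = K̄^U` is a finite abelian extension of `K`, unramified at
every `v ∉ S`, `v ∤ p` (the inertia groups lie in `rayKer ≤ U`) and — `K` having no real place — with
every infinite idèle a norm; so `Kˣ · W_{𝔪_S^m} ≤ 𝒩_F` and `F ⊆ C_{𝔪_S^m}` by the class field
correspondence. The `S = ∅` case is the tree's `PRamified.exists_ker_absRestrictNormalHom_rayClassField_le`.
[cite: NeukirchANT1999, Ch. VI §6 Thm. (6.1) and Def. (6.4)] [cite: Lang1990, Ch. 5 §5, pp. 106–107] -/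
theorem exists_ker_absRestrictNormalHom_rayClassField_le_of_rayKer_le [IsTotallyComplex K]
    {U : Subgroup (absoluteGaloisGroup K)} (hU : IsOpen (U : Set (absoluteGaloisGroup K)))
    (hle : rayKer K p S ≤ U) :
    ∃ m : ℕ, 0 < m ∧ (absRestrictNormalHom (rayClassField K (rayModulus K p S ^ m))).ker ≤ U := by
  classical
  -- `U` is normal (it contains the commutators)
  haveI hUn : U.Normal := ⟨fun u hu g ↦ by
    have h1 : g * u * g⁻¹ = ⁅g, u⁆ * u := by
      rw [commutatorElement_def, inv_mul_cancel_right]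
    rw [h1]
    exact U.mul_mem (hle (commutator_le_rayKer p S
      (Subgroup.commutator_mem_commutator (Subgroup.mem_top g) (Subgroup.mem_top u)))) hu⟩
  -- the fixed field `F = K̄^U`, a finite abelian extension with `Gal(K̄/F) = U`
  set F : IntermediateField K (AlgebraicClosure K) := IntermediateField.fixedField U with hFdef
  have hFU : F.fixingSubgroup = U := fixingSubgroup_fixedField_of_isOpen U hU
  haveI : FiniteDimensional K F := finiteDimensional_fixedField_of_isOpen U hU
  haveI : IsGalois K F := by
    rw [← InfiniteGalois.normal_iff_isGalois, hFU]
    exact hUn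
  have hker : (absRestrictNormalHom F).ker = U := by
    ext γ
    rw [MonoidHom.mem_ker, absRestrictNormalHom_eq_one_iff, hFU]
    rfl
  haveI : IsAbelianGalois K F :=
    { is_comm := ⟨fun a b ↦ by
        obtain ⟨α, rfl⟩ := absRestrictNormalHom_surjective F a
        obtain ⟨β, rfl⟩ := absRestrictNormalHom_surjective F b
        rw [← commutatorElement_eq_one_iff_mul_comm, ← map_commutatorElement, ← MonoidHom.mem_ker,
          hker]
        exact hle (commutator_le_rayKer p S
          (Subgroup.commutator_mem_commutator (Subgroup.mem_top α) (Subgroup.mem_top β)))⟩ }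
  haveI : NumberField F := NumberField.of_module_finite K F
  -- `F` is unramified at every finite `v ∉ S`, `v ∤ p`; there are no real places
  have hunr : ∀ v : HeightOneSpectrum (𝓞 K), v ∉ S → (p : 𝓞 K) ∉ v.asIdeal →
      Algebra.IsUnramifiedIn (𝓞 F) v.asIdeal := fun v hvS hv ↦
    (isUnramifiedIn_iff_forall_inertia_absRestrictNormalHom_eq_one F v).mpr fun 𝔓 h𝔓 g hg ↦ by
      rw [← MonoidHom.mem_ker, hker]
      exact hle (inertia_le_rayKer p S hvS hv h𝔓 hg)
  have hcc : ∀ (w : InfinitePlace K) (hw : w.IsReal) (c : absoluteGaloisGroup K),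
      IsComplexConjugationAt hw c → absRestrictNormalHom F c = 1 := fun w hw _ _ ↦
    absurd (IsTotallyComplex.isComplex w) (InfinitePlace.not_isComplex_iff_isReal.mpr hw)
  -- so `Kˣ · W_{𝔪^m} ≤ 𝒩_F` for some `m ≥ 1`, and `F ⊆ C_{𝔪^m}`
  obtain ⟨m, hm0, hm⟩ :=
    exists_principalIdeles_sup_congruenceUnitIdeles_rayModulus_pow_le_normGroup p S F hunr
  have hray : principalIdeles K ⊔ rayUnitIdeles K (rayModulus K p S ^ m) ≤ Automorphic.normGroup K F :=
    PRamified.principalIdeles_sup_rayUnitIdeles_le_of_infiniteIdeles_mem (rayModulus_pow_ne_bot p S m) hm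
      fun y ↦ PRamified.infiniteIdeles_mem_normGroup_of_forall_isComplexConjugationAt F hcc y
  have hFle : F ≤ rayClassField K (rayModulus K p S ^ m) := le_rayClassField_of_le_normGroup hray
  exact ⟨m, hm0, (ker_absRestrictNormalHom_anti' hFle).trans hker.le⟩

/-- **`Gal(K̄/K(𝔣p^∞)) = ⋂_m Gal(K̄/C_{𝔪_S^m})`, the inclusion `⊇`** (`K` totally complex): an element of
`Γ_K` restricting trivially to every `C_{𝔪_S^m}`, `m ≥ 1`, lies in the closed subgroup `rayKer K p S`
(a closed subgroup of the profinite `Γ_K` is the intersection of the open subgroups containing it,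
and each of these contains some `Gal(K̄/C_{𝔪_S^m})`). [cite: NeukirchANT1999, Ch. IV §1 Thm. (1.2)]
[cite: Lang1990, Ch. 5 §5, pp. 106–107] -/
theorem mem_rayKer_of_forall_absRestrictNormalHom_rayClassField_eq_one [IsTotallyComplex K]
    {γ : absoluteGaloisGroup K}
    (hγ : ∀ m : ℕ, 0 < m → absRestrictNormalHom (rayClassField K (rayModulus K p S ^ m)) γ = 1) :
    γ ∈ rayKer K p S := by
  classical
  by_contra hγH
  haveI := rayKer_normal p S
  set H : Subgroup (absoluteGaloisGroup K) := rayKer K p S with hHdef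
  -- the closed coset `Hγ` misses `1`, so some open normal subgroup `N` misses `Hγ`
  have hclosed : IsClosed ((fun h : absoluteGaloisGroup K ↦ h * γ) '' (H : Set (absoluteGaloisGroup K))) :=
    (Homeomorph.mulRight γ).isClosedMap _ (isClosed_rayKer p S)
  have h1 : (1 : absoluteGaloisGroup K) ∉ (fun h : absoluteGaloisGroup K ↦ h * γ) '' (H : Set _) := by
    rintro ⟨h, hh, h1⟩
    apply hγH
    have : γ = h⁻¹ := eq_inv_of_mul_eq_one_right h1
    rw [this]
    exact H.inv_mem hh
  have hnhds : ((fun h : absoluteGaloisGroup K ↦ h * γ) '' (H : Set _))ᶜ ∈ 𝓝 (1 : absoluteGaloisGroup K) :=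
    hclosed.isOpen_compl.mem_nhds h1
  obtain ⟨E, hEfd, hEn, hE⟩ :=
    (krullTopology_mem_nhds_one_iff_of_normal K (AlgebraicClosure K) _).mp hnhds
  haveI := hEfd
  haveI := hEn
  set N : Subgroup (absoluteGaloisGroup K) := (absRestrictNormalHom E).ker with hNdef
  have hNopen : IsOpen (N : Set (absoluteGaloisGroup K)) := isOpen_ker_absRestrictNormalHom E
  have hN : ∀ n ∈ N, n ∉ (fun h : absoluteGaloisGroup K ↦ h * γ) '' (H : Set _) := by
    intro n hn
    apply hE
    rw [hNdef, MonoidHom.mem_ker, absRestrictNormalHom_eq_one_iff] at hn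
    exact hn
  -- `U = H ⊔ N` is an open subgroup containing `H` but not `γ`
  have hUopen : IsOpen ((H ⊔ N : Subgroup (absoluteGaloisGroup K)) : Set (absoluteGaloisGroup K)) :=
    Subgroup.isOpen_mono le_sup_right hNopen
  obtain ⟨m, hm0, hm⟩ := exists_ker_absRestrictNormalHom_rayClassField_le_of_rayKer_le p S hUopen le_sup_left
  have hγU : γ ∈ H ⊔ N := hm (by rw [MonoidHom.mem_ker]; exact hγ m hm0)
  rw [← SetLike.mem_coe, Subgroup.mul_normal H N] at hγU
  obtain ⟨h, hh, n, hn, hγeq⟩ := hγU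
  refine hN n hn ⟨h⁻¹, H.inv_mem hh, ?_⟩
  change h⁻¹ * γ = n
  rw [← hγeq, inv_mul_cancel_left]

/-- **`Gal(K̄/K(𝔣p^∞)) = ⋂_{m ≥ 1} Gal(K̄/C_{𝔪_S^m})`** (both inclusions, `K` totally complex): `γ ∈ Γ_K`
lies in `rayKer K p S` iff it restricts trivially to every ray class field `C_{𝔪_S^m}` — the maximal
abelian extension of `K` unramified outside `S ∪ {w ∣ p}` is the union of these ray class fields,
i.e. `K(𝔣p^∞)`, de Shalit's `𝒢(𝔣p^∞) = Gal(K(𝔣p^∞)/K)` with `𝔣 = ∏_{w∈S} w^∞`.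
[cite: deShalit1987, II.4.12 Remark (i) (p. 67), II.4.16 (p. 76)] [cite: Lang1990, Ch. 5 §5, pp. 106–107] -/
theorem mem_rayKer_iff_forall_absRestrictNormalHom_rayClassField_eq_one [IsTotallyComplex K]
    (γ : absoluteGaloisGroup K) :
    γ ∈ rayKer K p S ↔
      ∀ m : ℕ, 0 < m → absRestrictNormalHom (rayClassField K (rayModulus K p S ^ m)) γ = 1 := by
  refine ⟨fun h m _ ↦ ?_, mem_rayKer_of_forall_absRestrictNormalHom_rayClassField_eq_one p S⟩
  rw [← MonoidHom.mem_ker]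
  exact rayKer_le_ker_absRestrictNormalHom_rayClassField_pow p S m h

/-! ### §4. The ray class tower `U_m = Gal(K̄/C_{𝔪_S^{m+1}})` -/

/-- The ray class fields grow with the exponent: `C_{𝔪^m} ≤ C_{𝔪^{m+1}}`.
[cite: NeukirchANT1999, Ch. VI §6 Def. (6.2)] -/
theorem rayClassField_rayModulus_pow_mono {m n : ℕ} (h : m ≤ n) :
    rayClassField K (rayModulus K p S ^ m) ≤ rayClassField K (rayModulus K p S ^ n) :=
  rayClassField_mono (rayUnitIdeles_anti (rayModulus_pow_ne_bot p S n) (Ideal.pow_le_pow_right h))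

/-- **The ray class tower of the modulus `𝔪_S`**: the open finite-index (normal) subgroups
`U_m = Gal(K̄/C_{𝔪_S^{m+1}})` of `Γ_K` — the tower `K(𝔣𝔭^n)` / `K(𝔤p^n)` along which de Shalit's
measures are inverse limits of group-ring elements (II.4.4 `F_n = K(𝔣𝔭^n)`, II.4.12 Remark (i),
II.4.14 Step 1). [cite: deShalit1987, II.4.12 Remark (i) (p. 67), II.4.14 Step 1 (p. 71)] -/
def rayClassTower (K : Type) [Field K] [NumberField K] (p : ℕ) [Fact p.Prime]
    (S : Finset (HeightOneSpectrum (𝓞 K))) : SubgroupTower (absoluteGaloisGroup K) where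
  U m := (absRestrictNormalHom (rayClassField K (rayModulus K p S ^ (m + 1)))).ker
  finiteIndex m := by
    haveI := Subgroup.quotient_finite_of_isOpen _
      (isOpen_ker_absRestrictNormalHom (rayClassField K (rayModulus K p S ^ (m + 1))))
    exact Subgroup.finiteIndex_of_finite_quotient
  succ_le m := ker_absRestrictNormalHom_anti' (rayClassField_rayModulus_pow_mono p S (Nat.le_succ (m + 1)))

/-- The levels of the ray class tower. [cite: deShalit1987, II.4.12 Remark (i) (p. 67)] -/
theorem rayClassTower_U (m : ℕ) :
    (rayClassTower K p S).U m = (absRestrictNormalHom (rayClassField K (rayModulus K p S ^ (m + 1)))).ker :=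
  rfl

/-- The levels of the ray class tower are open. [cite: deShalit1987, II.4.12 Remark (i) (p. 67)] -/
theorem isOpen_rayClassTower_U (m : ℕ) : IsOpen ((rayClassTower K p S).U m : Set (absoluteGaloisGroup K)) :=
  isOpen_ker_absRestrictNormalHom _

/-- The levels of the ray class tower are normal (so the tower carries the convolution of
`ProfiniteGroupDistributionRing.lean`). [cite: deShalit1987, I.3.1 (p. 16)] -/
theorem rayClassTower_U_normal (m : ℕ) : ((rayClassTower K p S).U m).Normal := by
  rw [rayClassTower_U]
  infer_instance

/-- `Gal(K̄/K(𝔣p^∞)) ≤ U_m` for every level. [cite: NeukirchANT1999, Ch. VI §6 Cor. (6.6)] -/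
theorem rayKer_le_rayClassTower_U (m : ℕ) : rayKer K p S ≤ (rayClassTower K p S).U m :=
  rayKer_le_ker_absRestrictNormalHom_rayClassField_pow p S (m + 1)

/-- **`⋂_m U_m ⊆ Gal(K̄/K(𝔣p^∞))`** for the ray class tower (`K` totally complex) — the Galois-side
hypothesis of `IsLMeasure.isKatzDistribution₂` and of `thmII414_exists_lMeasure`, DISCHARGED for the
canonical tower. [cite: deShalit1987, II.4.12 Remark (i) (p. 67), II.4.16 (p. 76)] [cite: Lang1990, Ch. 5 §5, pp. 106–107] -/
theorem iInter_rayClassTower_subset_rayKer [IsTotallyComplex K] :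
    ⋂ m, ((rayClassTower K p S).U m : Set (absoluteGaloisGroup K)) ⊆ rayKer K p S := by
  intro γ hγ
  refine mem_rayKer_of_forall_absRestrictNormalHom_rayClassField_eq_one p S fun m hm ↦ ?_
  obtain ⟨k, rfl⟩ := Nat.exists_eq_succ_of_ne_zero hm.ne'
  have h := Set.mem_iInter.mp hγ k
  rwa [SetLike.mem_coe, rayClassTower_U, MonoidHom.mem_ker] at h

/-- In fact `⋂_m U_m = Gal(K̄/K(𝔣p^∞))` (`K` totally complex). [cite: deShalit1987, II.4.16 (p. 76)] -/
theorem iInter_rayClassTower_eq_rayKer [IsTotallyComplex K] :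
    ⋂ m, ((rayClassTower K p S).U m : Set (absoluteGaloisGroup K)) = rayKer K p S :=
  Set.Subset.antisymm (iInter_rayClassTower_subset_rayKer p S)
    (Set.subset_iInter fun m ↦ rayKer_le_rayClassTower_U p S m)

/-- **The measure clause of `thmII414_exists_lMeasure` FROM A MEASURE ALONG THE RAY CLASS TOWER**: for
totally complex `K`, an integral `GroupDistribution` along `rayClassTower K p S` with de Shalit's
integrals (49)–(50) supplies the `∃ 𝒰 μ`-clause of the named fact (open levels, `⋂ U_m ⊆ rayKer`).
[cite: deShalit1987, II Thm. 4.14 (p. 71), II.4.16 (49)–(50) (p. 76–77)] -/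
theorem exists_tower_of_isLMeasure_rayClassTower [IsTotallyComplex K] {ι : PadicAlgCl p ≃+* ℂ}
    {v vbar : HeightOneSpectrum (𝓞 K)} {Ω δ : ℂ} {Ωp : ℂ_[p]}
    (μ : GroupDistribution (rayClassTower K p S) ℂ_[p]) (hb : μ.bound ≤ 1)
    (hμ : IsLMeasure ι v vbar S Ω δ Ωp (rayClassTower K p S) μ) :
    ∃ (𝒰 : SubgroupTower (absoluteGaloisGroup K)) (μ' : GroupDistribution 𝒰 ℂ_[p]),
      (∀ n, IsOpen (𝒰.U n : Set (absoluteGaloisGroup K))) ∧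
      (⋂ n, (𝒰.U n : Set (absoluteGaloisGroup K))) ⊆ rayKer K p S ∧
      μ'.bound ≤ 1 ∧ IsLMeasure ι v vbar S Ω δ Ωp 𝒰 μ' :=
  ⟨rayClassTower K p S, μ, isOpen_rayClassTower_U p S, iInter_rayClassTower_subset_rayKer p S, hb, hμ⟩

end DeShalit1987

end Literature.NumberTheory.EllipticCurves

end
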